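import Mathlib.RingTheory.Norm.Transitivity
import Mathlib.FieldTheory.Galois.Basic
import Mathlib.RingTheory.RootsOfUnity.PrimitiveRoots
import HarnessLib

/-!
# In a Galois extension with group `(ℤ/2)²` the norm of a `2`-power root of unity is the SQUARE of a `2`-power root of unity of the base
# (Washington §13.3 / de Shalit III §1.3: roots of unity die in `lim←` along a `ℤ_2²`-tower — the one-step computation)

Topic `FieldTheory/Galois`; namespace `Literature.FieldTheory.Galois`.  For a finite Galois extension `L'/L` whose Galois group has order `4` and
exponent `2` (`σ² = 1` for all `σ`, i.e. `Gal ≅ (ℤ/2)²`) and `ζ ∈ L'` with `ζ^{2^s} = 1`: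
★★ `exists_sq_eq_norm_of_pow_two_pow_eq_one` — **`N_{L'/L}(ζ) = η²` for some `η ∈ L` with `η^{2^s} = 1`.**
Proof: write `Gal = {1, σ₁, σ₂, σ₁σ₂}`, `σ₁ζ = ζ^B`, `σ₂ζ = ζ^A` with `A, B` odd and `A² ≡ B² ≡ 1 (mod N)`, `N = ord ζ = 2N'`; then `w := ζ·σ₁ζ = ζ^{B+1}` is fixed by
`σ₁`, has `w^{N'} = 1`, `σ₂w = w^A`, and `N ζ = w·σ₂w = w^{A+1} = η²` with `η = w^{(A+1)/2}`; `σ₂η = η^{A} = η·w^{(A²−1)/2} = η` since `N' ∣ (A²−1)/2`.  (For a CYCLIC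
group of order `2` or `4` the statement fails: `N_{ℚ(ζ₈)/ℚ(i)}(ζ₈) = −i`.)  This is the one-step input by which the roots of unity of the layers `S_{m+1} ⊋ S_m`
(`Gal(S_{m+1}/S_m) ≅ (𝒪_K/2)⁺ ≅ (ℤ/2)²`) of a symmetric `ℤ_2²`-ray class tower contribute only squares to the norm-coherent sequences of Rubin's `𝒞̄(S_m)`
(cell `bsd-print-cf2`, brick (c), depletion step).  THEOREMS ONLY (no definition, no named fact, no `sorry`, no instance).

## References
* [Washington1997] L. C. Washington, *Introduction to Cyclotomic Fields*, 2nd ed. (1997), §13.3 (norms of roots of unity along `ℤ_p`-towers; `U_∞ ≅ Λ ⊕ T_p(μ)`).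
* [deShalit1987] E. de Shalit, *Iwasawa theory of elliptic curves with complex multiplication* (1987), II.1.9 (p. 43), III §1.3 (p. 89–90).
-/

namespace Literature.FieldTheory.Galois

open scoped Classical

variable {L L' : Type*} [Field L] [Field L'] [Algebra L L'] [FiniteDimensional L L'] [IsGalois L L']

/-- In a group in which every element squares to `1`, any two elements commute. [folklore] -/
private theorem comm_of_sq_eq_one {G : Type*} [Group G] (h : ∀ g : G, g * g = 1) (a b : G) : a * b = b * a := by
  have hab := h (a * b)
  have ha := h a
  have hb := h b
  have hinv : ∀ g : G, g⁻¹ = g := fun g ↦ by rw [inv_eq_iff_mul_eq_one, h g]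
  calc a * b = (a * b)⁻¹ := (hinv _).symm
    _ = b⁻¹ * a⁻¹ := mul_inv_rev a b
    _ = b * a := by rw [hinv, hinv]

omit [IsGalois L L'] in
/-- The Galois group of order `4` and exponent `2` is `{1, σ₁, σ₂, σ₁σ₂}` for suitable `σ₁ ≠ σ₂` (the Klein four-group).
[cite: Washington1997, §13.3] -/
theorem exists_univ_eq_of_card_eq_four (hcard : Fintype.card (L' ≃ₐ[L] L') = 4) (hexp : ∀ σ : L' ≃ₐ[L] L', σ * σ = 1) :
    ∃ σ₁ σ₂ : L' ≃ₐ[L] L', σ₁ ≠ 1 ∧ σ₂ ≠ 1 ∧ σ₁ ≠ σ₂ ∧ σ₁ * σ₂ ≠ 1 ∧ σ₁ * σ₂ ≠ σ₁ ∧ σ₁ * σ₂ ≠ σ₂ ∧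
      (Finset.univ : Finset (L' ≃ₐ[L] L')) = {1, σ₁, σ₂, σ₁ * σ₂} := by
  have hinv : ∀ g : L' ≃ₐ[L] L', g⁻¹ = g := fun g ↦ by rw [inv_eq_iff_mul_eq_one, hexp g]
  obtain ⟨σ₁, hσ₁⟩ := Fintype.exists_ne_of_one_lt_card (by rw [hcard]; norm_num) (1 : L' ≃ₐ[L] L')
  -- a second non-trivial element outside `{1, σ₁}`
  obtain ⟨σ₂, hσ₂1, hσ₂⟩ : ∃ σ₂ : L' ≃ₐ[L] L', σ₂ ≠ 1 ∧ σ₂ ≠ σ₁ := by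
    by_contra hno
    push Not at hno
    have hsub : (Finset.univ : Finset (L' ≃ₐ[L] L')) ⊆ {1, σ₁} := fun σ _ ↦ by
      rcases eq_or_ne σ 1 with h | h
      · simp [h]
      · simp [hno σ h]
    have := Finset.card_le_card hsub
    rw [Finset.card_univ, hcard] at this
    exact absurd (this.trans (Finset.card_le_two)) (by norm_num)
  have h12 : σ₁ * σ₂ ≠ 1 := fun h ↦ hσ₂ (by
    have := congrArg (σ₁⁻¹ * ·) h
    simp only [← mul_assoc, inv_mul_cancel, one_mul, mul_one] at this
    rw [this, hinv])
  have h1 : σ₁ * σ₂ ≠ σ₁ := fun h ↦ hσ₂1 (by simpa using congrArg (σ₁⁻¹ * ·) h)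
  have h2 : σ₁ * σ₂ ≠ σ₂ := fun h ↦ hσ₁ (by simpa using congrArg (· * σ₂⁻¹) h)
  refine ⟨σ₁, σ₂, hσ₁, hσ₂1, hσ₂.symm, h12, h1, h2, ?_⟩
  symm
  apply Finset.eq_univ_of_card
  rw [hcard, Finset.card_insert_of_notMem, Finset.card_insert_of_notMem, Finset.card_pair h2.symm]
  · simp only [Finset.mem_insert, Finset.mem_singleton, not_or]
    exact ⟨hσ₂.symm, h1.symm⟩
  · simp only [Finset.mem_insert, Finset.mem_singleton, not_or]
    exact ⟨hσ₁.symm, hσ₂1.symm, h12.symm⟩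

omit [FiniteDimensional L L'] [IsGalois L L'] in
/-- An automorphism of a field sends a primitive `N`-th root of unity `ζ` to an ODD power `ζ^A` with `N ∣ A² − 1` when it is an involution (`σ² = 1`) and `2 ∣ N`.
[cite: Washington1997, §13.3] -/
theorem exists_odd_pow_eq_of_mul_self_eq_one {ζ : L'} {N : ℕ} [NeZero N] (hζ : IsPrimitiveRoot ζ N) (h2 : 2 ∣ N) (σ : L' ≃ₐ[L] L')
    (hσ : σ * σ = 1) : ∃ a : ℕ, σ ζ = ζ ^ (2 * a + 1) ∧ N ∣ (2 * a + 1) * (2 * a + 1) - 1 := by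
  have hN0 : 0 < N := Nat.pos_of_ne_zero (NeZero.ne N)
  obtain ⟨A, hAN, hA⟩ := hζ.eq_pow_of_pow_eq_one (ξ := σ ζ) (by rw [← map_pow, hζ.pow_eq_one, map_one])
  -- `A` is coprime to `N`, hence odd
  have hprim : IsPrimitiveRoot (σ ζ) N := hζ.map_of_injective σ.injective
  rw [← hA] at hprim
  have hcop : A.Coprime N := (hζ.pow_iff_coprime hN0 A).mp hprim
  have hodd : ¬ 2 ∣ A := fun h2A ↦ by
    have := Nat.dvd_gcd h2A h2
    rw [hcop] at this
    exact absurd this (by norm_num)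
  obtain ⟨a, ha⟩ : ∃ a, A = 2 * a + 1 := ⟨A / 2, by omega⟩
  refine ⟨a, by rw [← ha, hA], ?_⟩
  -- `ζ^{A²} = ζ`
  have hAA : ζ ^ (A * A) = ζ := by
    have e : σ (σ ζ) = ζ := by rw [← AlgEquiv.mul_apply, hσ, AlgEquiv.one_apply]
    rw [← hA, map_pow, ← hA, ← pow_mul] at e
    exact e
  have hζ0 : ζ ≠ 0 := hζ.ne_zero (NeZero.ne N)
  have h1 : ζ ^ (A * A - 1) = 1 := by
    have hAA1 : 1 ≤ A * A := by rw [ha]; nlinarith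
    have e : ζ ^ (A * A - 1) * ζ = 1 * ζ := by rw [← pow_succ, Nat.sub_add_cancel hAA1, hAA, one_mul]
    exact mul_right_cancel₀ hζ0 e
  rw [← ha]
  exact (hζ.pow_eq_one_iff_dvd _).mp h1

/-- ★★ **In a `(ℤ/2)²`-extension, the norm of a `2`-power root of unity is the square of a `2`-power root of unity of the base**: `L'/L` finite Galois with
`#Gal(L'/L) = 4` and `σ² = 1` for all `σ`; `ζ ∈ L'`, `ζ^{2^s} = 1` ⟹ `∃ η ∈ L`, `η^{2^s} = 1`, `N_{L'/L}(ζ) = η²`.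
[cite: Washington1997, §13.3] [cite: deShalit1987, III §1.3 (p. 89–90)] -/
theorem exists_sq_eq_norm_of_pow_two_pow_eq_one (hcard : Fintype.card (L' ≃ₐ[L] L') = 4) (hexp : ∀ σ : L' ≃ₐ[L] L', σ * σ = 1)
    {ζ : L'} {s : ℕ} (hζs : ζ ^ 2 ^ s = 1) :
    ∃ η : L, η ^ 2 ^ s = 1 ∧ algebraMap L L' (η ^ 2) = algebraMap L L' (Algebra.norm L ζ) := by
  obtain ⟨σ₁, σ₂, hσ₁, hσ₂, h12ne, h12, h1, h2, huniv⟩ := exists_univ_eq_of_card_eq_four hcard hexp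
  -- the norm as the product over `{1, σ₁, σ₂, σ₁σ₂}`
  have hnorm : algebraMap L L' (Algebra.norm L ζ) = ζ * (σ₁ ζ * (σ₂ ζ * (σ₁ * σ₂) ζ)) := by
    rw [Algebra.norm_eq_prod_automorphisms, huniv, Finset.prod_insert, Finset.prod_insert, Finset.prod_pair h2.symm, AlgEquiv.one_apply]
    · simp only [Finset.mem_insert, Finset.mem_singleton, not_or]; exact ⟨h12ne, h1.symm⟩
    · simp only [Finset.mem_insert, Finset.mem_singleton, not_or]; exact ⟨hσ₁.symm, hσ₂.symm, h12.symm⟩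
  -- the order `N` of `ζ`
  have hfin : IsOfFinOrder ζ := isOfFinOrder_iff_pow_eq_one.mpr ⟨2 ^ s, pow_pos two_pos s, hζs⟩
  set N := orderOf ζ with hN
  have hζ : IsPrimitiveRoot ζ N := IsPrimitiveRoot.orderOf ζ
  have hNdvd : N ∣ 2 ^ s := orderOf_dvd_of_pow_eq_one hζs
  haveI : NeZero N := ⟨hfin.orderOf_pos.ne'⟩
  -- an element of `L` from a `Gal`-fixed element of `L'`
  have descend : ∀ η' : L', (∀ σ : L' ≃ₐ[L] L', σ η' = η') → η' ^ 2 ^ s = 1 → η' * η' = algebraMap L L' (Algebra.norm L ζ) →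
      ∃ η : L, η ^ 2 ^ s = 1 ∧ algebraMap L L' (η ^ 2) = algebraMap L L' (Algebra.norm L ζ) := by
    intro η' hfix hpow hsq
    obtain ⟨η, hη⟩ := (IsGalois.mem_range_algebraMap_iff_fixed η').mpr hfix
    refine ⟨η, ?_, by rw [map_pow, hη, sq, hsq]⟩
    apply (algebraMap L L').injective
    rw [map_pow, hη, hpow, map_one]
  by_cases hN1 : N = 1
  · -- `ζ = 1`
    have hζ1 : ζ = 1 := orderOf_eq_one_iff.mp (hN ▸ hN1 : orderOf ζ = 1)
    refine descend 1 (fun σ ↦ map_one σ) (one_pow _) ?_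
    rw [hnorm, hζ1]; simp
  -- `2 ∣ N`
  have h2N : 2 ∣ N := by
    obtain ⟨j, -, hj⟩ := (Nat.dvd_prime_pow Nat.prime_two).mp hNdvd
    rcases j with _ | j
    · exact absurd (by simpa using hj) hN1
    · rw [hj, pow_succ]; exact dvd_mul_left 2 _
  obtain ⟨N', hN'⟩ := h2N
  -- exponents of `σ₁`, `σ₂`
  obtain ⟨b, hB, hBdvd⟩ := exists_odd_pow_eq_of_mul_self_eq_one hζ ⟨N', hN'⟩ σ₁ (hexp σ₁)
  obtain ⟨a, hA, hAdvd⟩ := exists_odd_pow_eq_of_mul_self_eq_one hζ ⟨N', hN'⟩ σ₂ (hexp σ₂)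
  -- `w = ζ·σ₁ζ = ζ^{2(b+1)}`, `w^{N'} = 1`, `σ₁ w = w`, `σ₂ w = w^A`
  set w : L' := ζ * σ₁ ζ with hw
  have hwpow : w = ζ ^ (2 * (b + 1)) := by rw [hw, hB, ← pow_succ']; ring_nf
  have hwN' : w ^ N' = 1 := by
    rw [hwpow, ← pow_mul, show 2 * (b + 1) * N' = N * (b + 1) by rw [hN']; ring, pow_mul, hζ.pow_eq_one, one_pow]
  have hσ₁w : σ₁ w = w := by
    rw [hw, map_mul, ← AlgEquiv.mul_apply, hexp σ₁, AlgEquiv.one_apply, mul_comm]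
  have hcomm : σ₂ * σ₁ = σ₁ * σ₂ := comm_of_sq_eq_one hexp σ₂ σ₁
  have hσ₂w : σ₂ w = w ^ (2 * a + 1) := by
    rw [hw, map_mul, ← AlgEquiv.mul_apply, hcomm, AlgEquiv.mul_apply, hA, map_pow, ← mul_pow]
  -- `η' = w^{a+1}`
  set η' : L' := w ^ (a + 1) with hη'
  have hσ₁η : σ₁ η' = η' := by rw [hη', map_pow, hσ₁w]
  have hσ₂η : σ₂ η' = η' := by
    rw [hη', map_pow, hσ₂w, ← pow_mul]
    -- `w^{(2a+1)(a+1)} = w^{a+1} · w^{2a(a+1)}` and `N' ∣ 2a(a+1)`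
    have hdvd : N' ∣ 2 * a * (a + 1) := by
      have e : (2 * a + 1) * (2 * a + 1) - 1 = 2 * (2 * a * (a + 1)) := by
        have : 1 ≤ (2 * a + 1) * (2 * a + 1) := by nlinarith
        zify [this]; ring
      rw [e, hN'] at hAdvd
      exact Nat.dvd_of_mul_dvd_mul_left two_pos hAdvd
    obtain ⟨t, ht⟩ := hdvd
    rw [show (2 * a + 1) * (a + 1) = a + 1 + 2 * a * (a + 1) by ring, pow_add, ht, pow_mul, hwN', one_pow, mul_one]
  have hfix : ∀ σ : L' ≃ₐ[L] L', σ η' = η' := by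
    intro σ
    have hσ : σ ∈ (Finset.univ : Finset (L' ≃ₐ[L] L')) := Finset.mem_univ σ
    rw [huniv] at hσ
    simp only [Finset.mem_insert, Finset.mem_singleton] at hσ
    rcases hσ with rfl | rfl | rfl | rfl
    · rfl
    · exact hσ₁η
    · exact hσ₂η
    · rw [AlgEquiv.mul_apply, hσ₂η, hσ₁η]
  refine descend η' hfix ?_ ?_
  · -- `η'^{2^s} = 1`
    rw [hη', hwpow, ← pow_mul, ← pow_mul, show 2 * (b + 1) * ((a + 1) * 2 ^ s) = 2 ^ s * (2 * (b + 1) * (a + 1)) by ring, pow_mul, hζs, one_pow]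
  · -- `η'² = N ζ = w · σ₂ w = w^{2a+2}`
    rw [hnorm, hη', ← pow_add, show a + 1 + (a + 1) = (2 * a + 1) + 1 by ring, pow_succ, ← hσ₂w, hw, map_mul, ← AlgEquiv.mul_apply, hcomm]
    ring

end Literature.FieldTheory.Galois
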